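import Summits.BirchSwinnertonDyer.BirchSwinnertonDyer.Theorems.SignedLowerHalvesBDKimSignedCharValueRankZeroOfPoitouTateSha
import Summits.BirchSwinnertonDyer.BirchSwinnertonDyer.Theorems.ThetaPartnerAtTwoSignedControlAtTwoStubPoitouTateShaRat
import HarnessLib

set_option linter.dupNamespace false -- `…BirchSwinnertonDyer.BirchSwinnertonDyer…` is the cell's nested layout (D-0017)
set_option autoImplicit false

/-!
# F10 — Kim 2013 Cor. 3.15 (`BDKim2013.cor315_signedCharValue_rankZero`, item 19288) is a THEOREM OF THE TREE: the signed
# characteristic-value formula in analytic rank 0 at an odd supersingular prime, UNCONDITIONAL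
# (LADDER-BSD D-0154 (2), INPUTS-LIST-2 rows 6–8; routes `SignedLowerHalves` / `SignedBaseChange` / `PrintX6`)

Seat `bsd-inputs-honda-p1` (gen 6, idle INPUTS prover of the desk `pub/bsd-wall/bsd-inputs`), `--workitem` stmt-BirchSwinnertonDyer-19288.
THEOREMS ONLY (no definition, no named fact, no `sorry`); no new mathematics — a two-line composition.

The chain (all landed): kim315-p1 / k4-p1 / t9-p1 proved `KimCor315.cor315_of_poitouTate_two_rows (hPTs : PT-Sel ℚ) (hPT : PT-Ш ℚ)`
(T9, p624074: Greenberg 1999 engine, Cassels 4.13 from Poitou–Tate, `Ш² = 0` at odd `p`, the chromatic transport by the Honda systems of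
Sprung 2012 Thm. 2.2 proved by honda-p1 g0, INJ/COINV); T12 (p626490, this seat) discharged PT-Sel by bsd-schneider's
`poitouTate_selmerStructure_duality_holds`; and PT-Ш is, since 2026-08-28T11:36Z, a THEOREM for every number field:
`SignedEC.PoitouTateShaRat.poitouTate_sha_tateDual_numberField (K)` (bsd-wall K4, k4-p1 g0, p629917, module
`Theorems.ThetaPartnerAtTwoSignedControlAtTwoStubPoitouTateShaRat`; item 20462 closed by chl-p2 g7, p630237). Hence the named fact itself
holds with NO hypothesis (§1), and the three route declarations carrying item 19288 (all `def … : Prop :=` aliases of it) follow by `exact` (§2).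

Honest framing: F10 is a published theorem (B. D. Kim, Compos. Math. 149 (2013), Cor. 3.15) whose in-tree proof was conditional only on the
two classical Poitou–Tate inputs; both are now kernel theorems, so F10 is UNCONDITIONAL AS TYPED. Closing item 19288 removes one displayed
print input of `PrintX6` / `SignedLowerHalves` / `SignedBaseChange`; it is NOT a case of BSD, no crux of substance and no summit statement is
proved, and the Birch–Swinnerton-Dyer conjecture is NOT proved by any of this.
References: [BDKim2013] Cor. 3.15 (p. 199); [GreenbergLNM1716] §4; [MilneADT2006] Ch. I, Thm. 4.10; [Sprung2012] Thm. 2.2.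
-/

noncomputable section

namespace Summit.BirchSwinnertonDyer.BirchSwinnertonDyer.Theorems.KimCor315

open Literature.NumberTheory.GaloisCohomology Literature.NumberTheory.EllipticCurves

/-! ## §1 The named fact, hypothesis-free -/

/-- **Kim 2013 Cor. 3.15 — the named fact `BDKim2013.cor315_signedCharValue_rankZero`, PROVED (no hypothesis):**
`cor315_of_poitouTateSha` (F10 ⟸ PT-Ш(ℚ)) at the tree theorem `SignedEC.PoitouTateShaRat.poitouTate_sha_tateDual_numberField ℚ`
(Poitou–Tate 4.10 (a) over `ℚ`, p629917). Unconditional; BSD is not proved by this. [cite: BDKim2013, Cor. 3.15 (p. 199)]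
[cite: MilneADT2006, Ch. I, Thm. 4.10 (a)(b)] -/
theorem cor315_signedCharValue_rankZero_holds : BDKim2013.cor315_signedCharValue_rankZero :=
  cor315_of_poitouTateSha (SignedEC.PoitouTateShaRat.poitouTate_sha_tateDual_numberField ℚ)

/-! ## §2 Item 19288 on its three routes, by name -/

/-- **Route `SignedLowerHalves`, support `BDKimSignedCharValueRankZero` (item 19288) — PROVED (by name).** Unconditional; closes item
19288; BSD is not proved by this. [cite: BDKim2013, Cor. 3.15 (p. 199)] [cite: MilneADT2006, Ch. I, Thm. 4.10] -/
theorem signedLowerHalves_bdKimSignedCharValueRankZero_proof :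
    Summit.BirchSwinnertonDyer.BirchSwinnertonDyer.Theses.SignedLowerHalves.BDKimSignedCharValueRankZero := by
  unfold Summit.BirchSwinnertonDyer.BirchSwinnertonDyer.Theses.SignedLowerHalves.BDKimSignedCharValueRankZero
  exact cor315_signedCharValue_rankZero_holds

/-- **Route `SignedBaseChange`, support `BDKimSignedCharValueRankZero` (the same item 19288) — PROVED (by name).** Unconditional; BSD is
not proved by this. [cite: BDKim2013, Cor. 3.15 (p. 199)] [cite: MilneADT2006, Ch. I, Thm. 4.10] -/
theorem signedBaseChange_bdKimSignedCharValueRankZero_proof :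
    Summit.BirchSwinnertonDyer.BirchSwinnertonDyer.Theses.SignedBaseChange.BDKimSignedCharValueRankZero := by
  unfold Summit.BirchSwinnertonDyer.BirchSwinnertonDyer.Theses.SignedBaseChange.BDKimSignedCharValueRankZero
  exact cor315_signedCharValue_rankZero_holds

/-- **Route `PrintX6`, support `InputKimCor315` (the same item 19288) — PROVED (by name).** Unconditional; BSD is not proved by this.
[cite: BDKim2013, Cor. 3.15 (p. 199)] [cite: MilneADT2006, Ch. I, Thm. 4.10] -/
theorem printX6_inputKimCor315_proof :
    Summit.BirchSwinnertonDyer.BirchSwinnertonDyer.Theses.PrintX6.InputKimCor315 := by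
  unfold Summit.BirchSwinnertonDyer.BirchSwinnertonDyer.Theses.PrintX6.InputKimCor315
  exact cor315_signedCharValue_rankZero_holds

end Summit.BirchSwinnertonDyer.BirchSwinnertonDyer.Theorems.KimCor315

end
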